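import Summits.KontsevichZagierPeriods.KontsevichZagierPeriods.Theorems.SoloInformedNLReindex
import Summits.KontsevichZagierPeriods.KontsevichZagierPeriods.Theorems.SoloInformedCrossingNumber
import HarnessLib
import HarnessLib.Audit

/-!
# SoloInformed — the shear sheets of the flattened right-hand side (Newton–Leibniz elimination, file 4c-ii-b)

Solo programme `solo-KontsevichZagierPeriods-informed`, session s245 (K-NF, `paper/nl-elimination.md`
§7.2, FILE 4c-ii).

The right-hand side of a Newton–Leibniz datum, `[r'] = [∫_τ (F(x,b x) − F(x,a x)) dx]`, is replaced
(torsion/flattening, files 584–588) by the flat representation `∫_{τ × [0,1]} g(x) dx dt`,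
`g := r'.integrand`.  Over an OPEN base cell `S ⊆ τ` on which `g` and `h := F(·, a ·)` are smooth
and `g` has a sign, the SHEAR `G(x,t) := h x + t·g x` has `∂G/∂t = g x` and maps the slab
`S × [0,1]` onto the region between the graphs of `h` and `h + g = F(·, b ·)`; by the sheet lemma
(file 593) the slab piece is equivalent (`∈ relations₁₂`) to `±[𝟙_{Ψ_G(S × [0,1])}]`.

* `soloInformedShear h g`, its semialgebraicity on the cylinder over `S`, smoothness, fibre
  derivative `g x` and last partial `fderiv … (e_last) = g (init z)`;
* `soloInformedPosShearSheet` / `soloInformedNegShearSheet`: the sheets of a slab piece `ρ`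
  (`ρ.domain = band S 0 1`, `ρ.integrand z = g (init z)`) for `g > 0` / `g < 0` on `S`, with
  `[ρ] − [pos] ∈ relations₁₂`, `[ρ] + [neg] ∈ relations₁₂`;
* the fibres of the image `Ψ_G '' (S × [0,1])` and the signed multiplicity
  `ε·𝟙[w ∈ image] = sInd (h x) (h x + g x) (w last)` off the two boundary graphs.

References: this work (THEOREM NF, `paper/nl-elimination.md` §2).
-/

noncomputable section

open scoped BigOperators Topology ContDiff

namespace Summit.KontsevichZagierPeriods.KontsevichZagierPeriods.Theorems

open Set MeasureTheory Filter MvPolynomial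
open Literature.ModelTheory.ExponentialFields
open Literature.NumberTheory.Transcendental Literature.NumberTheory.Transcendental.KZ

variable {n : ℕ}

/-! ### The shear -/

/-- The **shear primitive** `G(x, t) = h x + t · g x` (last coordinate `t`). -/
def soloInformedShear (h g : (Fin n → ℝ) → ℝ) : (Fin (n + 1) → ℝ) → ℝ :=
  fun z => h (Fin.init z) + z (Fin.last n) * g (Fin.init z)

/-- The shear on a point `(x, t)`. -/
@[simp] theorem soloInformed_shear_snoc (h g : (Fin n → ℝ) → ℝ) (x : Fin n → ℝ) (t : ℝ) :
    soloInformedShear h g (Fin.snoc x t) = h x + t * g x := by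
  simp [soloInformedShear]

/-- The shear is `ℚ`-semialgebraic on the cylinder over `S` when `h, g` are on `S`. -/
theorem soloInformed_isSemialgebraicFunOn_shear {S : Set (Fin n → ℝ)} (hS : IsSemialgebraic ℚ S)
    {h g : (Fin n → ℝ) → ℝ} (hh : IsSemialgebraicFunOn ℚ S h) (hg : IsSemialgebraicFunOn ℚ S g) :
    IsSemialgebraicFunOn ℚ {z : Fin (n + 1) → ℝ | Fin.init z ∈ S} (soloInformedShear h g) := by
  have h1 := hh.comp_init
  have h2 := hg.comp_init
  have h3 : IsSemialgebraicFunOn ℚ {z : Fin (n + 1) → ℝ | Fin.init z ∈ S}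
      (fun z => z (Fin.last n)) := by
    simpa using isSemialgebraicFunOn_aeval (R := ℝ) hS.setOf_init_mem
      (X (Fin.last n) : MvPolynomial (Fin (n + 1)) ℚ)
  have h4 := IsSemialgebraicFunOn.add_holds h1 (IsSemialgebraicFunOn.mul_holds h3 h2)
  convert h4 using 1
  exact funext fun z => rfl

/-- The cylinder over an open set is open. -/
theorem soloInformed_isOpen_setOf_init_mem {S : Set (Fin n → ℝ)} (hSo : IsOpen S) :
    IsOpen {z : Fin (n + 1) → ℝ | Fin.init z ∈ S} :=
  hSo.preimage (continuous_pi fun _ => continuous_apply _)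

/-- The shear is smooth on the cylinder over `S` when `h, g` are smooth on the open set `S`. -/
theorem soloInformed_contDiffOn_shear {S : Set (Fin n → ℝ)} {h g : (Fin n → ℝ) → ℝ}
    (hh : ContDiffOn ℝ ∞ h S) (hg : ContDiffOn ℝ ∞ g S) :
    ContDiffOn ℝ ∞ (soloInformedShear h g) {z : Fin (n + 1) → ℝ | Fin.init z ∈ S} := by
  have hinit : ContDiff ℝ ∞ (Fin.init : (Fin (n + 1) → ℝ) → Fin n → ℝ) :=
    contDiff_pi.2 fun i => contDiff_apply ℝ ℝ (Fin.castSucc i)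
  have hmaps : MapsTo (Fin.init : (Fin (n + 1) → ℝ) → Fin n → ℝ)
      {z : Fin (n + 1) → ℝ | Fin.init z ∈ S} S := fun z hz => hz
  exact (hh.comp hinit.contDiffOn hmaps).add
    ((contDiff_apply ℝ ℝ (Fin.last n)).contDiffOn.mul (hg.comp hinit.contDiffOn hmaps))

/-- The shear is differentiable at every point of the open cylinder over `S`. -/
theorem soloInformed_hasFDerivAt_shear {S : Set (Fin n → ℝ)} (hSo : IsOpen S)
    {h g : (Fin n → ℝ) → ℝ} (hh : ContDiffOn ℝ ∞ h S) (hg : ContDiffOn ℝ ∞ g S)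
    {z : Fin (n + 1) → ℝ} (hz : Fin.init z ∈ S) :
    HasFDerivAt (soloInformedShear h g) (fderiv ℝ (soloInformedShear h g) z) z :=
  soloInformed_hasFDerivAt_of_contDiffOn (soloInformed_isOpen_setOf_init_mem hSo)
    (soloInformed_contDiffOn_shear hh hg) hz

/-- The fibre derivative of the shear is `g x`. -/
theorem soloInformed_hasDerivAt_shear_fibre (h g : (Fin n → ℝ) → ℝ) (x : Fin n → ℝ) (t : ℝ) :
    HasDerivAt (fun s : ℝ => soloInformedShear h g (Fin.snoc x s)) (g x) t := by
  have : (fun s : ℝ => soloInformedShear h g (Fin.snoc x s)) = fun s => h x + s * g x :=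
    funext fun s => soloInformed_shear_snoc h g x s
  rw [this]
  exact (hasDerivAt_mul_const (g x)).const_add (h x)

/-- The last partial derivative of the shear is `g (init z)`. -/
theorem soloInformed_fderiv_shear_single_last {S : Set (Fin n → ℝ)} (hSo : IsOpen S)
    {h g : (Fin n → ℝ) → ℝ} (hh : ContDiffOn ℝ ∞ h S) (hg : ContDiffOn ℝ ∞ g S)
    {z : Fin (n + 1) → ℝ} (hz : Fin.init z ∈ S) :
    fderiv ℝ (soloInformedShear h g) z (Pi.single (Fin.last n) 1) = g (Fin.init z) :=
  soloInformed_fderiv_single_last_eq (soloInformed_hasFDerivAt_shear hSo hh hg hz)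
    (soloInformed_hasDerivAt_shear_fibre h g (Fin.init z) (z (Fin.last n)))

/-! ### Slab pieces and their shear sheets -/

section Slab

variable {S : Set (Fin n → ℝ)} {h g : (Fin n → ℝ) → ℝ} {ρ : IntegralRep (n + 1)}

/-- Points of a slab piece have base point in `S`. -/
theorem soloInformed_init_mem_of_slab
    (hdom : ρ.domain = KZlog.band S (fun _ => 0) (fun _ => 1)) {z : Fin (n + 1) → ℝ}
    (hz : z ∈ ρ.domain) : Fin.init z ∈ S :=
  soloInformed_init_mem_of_mem_band (hdom ▸ hz)

/-- The shear is semialgebraic on the slab piece. -/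
theorem soloInformed_slab_hF (hS : IsSemialgebraic ℚ S) (hh : IsSemialgebraicFunOn ℚ S h)
    (hg : IsSemialgebraicFunOn ℚ S g) (hdom : ρ.domain = KZlog.band S (fun _ => 0) (fun _ => 1)) :
    IsSemialgebraicFunOn ℚ ρ.domain (soloInformedShear h g) :=
  (soloInformed_isSemialgebraicFunOn_shear hS hh hg).mono
    (fun _ hz => soloInformed_init_mem_of_slab hdom hz) ρ.isSemialgebraic_domain

/-- The shear is differentiable on the slab piece. -/
theorem soloInformed_slab_hd (hSo : IsOpen S) (hhs : ContDiffOn ℝ ∞ h S)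
    (hgs : ContDiffOn ℝ ∞ g S) (hdom : ρ.domain = KZlog.band S (fun _ => 0) (fun _ => 1)) :
    ∀ z ∈ ρ.domain, HasFDerivAt (soloInformedShear h g) (fderiv ℝ (soloInformedShear h g) z) z :=
  fun _ hz => soloInformed_hasFDerivAt_shear hSo hhs hgs (soloInformed_init_mem_of_slab hdom hz)

/-- The slab piece has convex fibres. -/
theorem soloInformed_slab_hconv (hdom : ρ.domain = KZlog.band S (fun _ => 0) (fun _ => 1)) :
    ∀ x, Convex ℝ (soloInformedFibre ρ.domain x) := fun x => by
  rw [hdom]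
  exact soloInformed_convex_fibre_slab S (fun _ => 0) (fun _ => 1) x

/-- The integrand of the slab piece is the last partial of the shear. -/
theorem soloInformed_slab_hjac (hSo : IsOpen S) (hhs : ContDiffOn ℝ ∞ h S)
    (hgs : ContDiffOn ℝ ∞ g S) (hdom : ρ.domain = KZlog.band S (fun _ => 0) (fun _ => 1))
    (hint : ∀ z ∈ ρ.domain, ρ.integrand z = g (Fin.init z)) :
    ∀ z ∈ ρ.domain, ρ.integrand z =
      fderiv ℝ (soloInformedShear h g) z (Pi.single (Fin.last n) 1) := fun z hz => by
  rw [hint z hz, soloInformed_fderiv_shear_single_last hSo hhs hgs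
    (soloInformed_init_mem_of_slab hdom hz)]

/-- **Positive shear sheet** of a slab piece (`g > 0` on `S`). -/
def soloInformedPosShearSheet (ρ : IntegralRep (n + 1)) (S : Set (Fin n → ℝ))
    (h g : (Fin n → ℝ) → ℝ) (hS : IsSemialgebraic ℚ S) (hSo : IsOpen S)
    (hh : IsSemialgebraicFunOn ℚ S h) (hg : IsSemialgebraicFunOn ℚ S g)
    (hhs : ContDiffOn ℝ ∞ h S) (hgs : ContDiffOn ℝ ∞ g S)
    (hdom : ρ.domain = KZlog.band S (fun _ => 0) (fun _ => 1))
    (hint : ∀ z ∈ ρ.domain, ρ.integrand z = g (Fin.init z)) (hpos : ∀ x ∈ S, 0 < g x) :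
    IntegralRep (n + 1) :=
  soloInformedPosSheet ρ (soloInformedShear h g) (fun z => fderiv ℝ (soloInformedShear h g) z)
    (soloInformed_slab_hF hS hh hg hdom) (soloInformed_slab_hd hSo hhs hgs hdom)
    (soloInformed_slab_hconv hdom) (soloInformed_slab_hjac hSo hhs hgs hdom hint)
    (fun z hz => by rw [hint z hz]; exact hpos _ (soloInformed_init_mem_of_slab hdom hz))

/-- The positive shear sheet has domain `Ψ_G '' ρ.domain`. -/
@[simp] theorem soloInformed_posShearSheet_domain (ρ : IntegralRep (n + 1)) (S : Set (Fin n → ℝ))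
    (h g : (Fin n → ℝ) → ℝ) (hS : IsSemialgebraic ℚ S) (hSo : IsOpen S)
    (hh : IsSemialgebraicFunOn ℚ S h) (hg : IsSemialgebraicFunOn ℚ S g)
    (hhs : ContDiffOn ℝ ∞ h S) (hgs : ContDiffOn ℝ ∞ g S)
    (hdom : ρ.domain = KZlog.band S (fun _ => 0) (fun _ => 1))
    (hint : ∀ z ∈ ρ.domain, ρ.integrand z = g (Fin.init z)) (hpos : ∀ x ∈ S, 0 < g x) :
    (soloInformedPosShearSheet ρ S h g hS hSo hh hg hhs hgs hdom hint hpos).domain =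
      soloInformedLastSubst (soloInformedShear h g) '' ρ.domain :=
  rfl

/-- The positive shear sheet has integrand `1`. -/
@[simp] theorem soloInformed_posShearSheet_integrand (ρ : IntegralRep (n + 1))
    (S : Set (Fin n → ℝ)) (h g : (Fin n → ℝ) → ℝ) (hS : IsSemialgebraic ℚ S) (hSo : IsOpen S)
    (hh : IsSemialgebraicFunOn ℚ S h) (hg : IsSemialgebraicFunOn ℚ S g)
    (hhs : ContDiffOn ℝ ∞ h S) (hgs : ContDiffOn ℝ ∞ g S)
    (hdom : ρ.domain = KZlog.band S (fun _ => 0) (fun _ => 1))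
    (hint : ∀ z ∈ ρ.domain, ρ.integrand z = g (Fin.init z)) (hpos : ∀ x ∈ S, 0 < g x) :
    (soloInformedPosShearSheet ρ S h g hS hSo hh hg hhs hgs hdom hint hpos).integrand =
      fun _ => 1 :=
  rfl

/-- **The slab piece minus its positive shear sheet is a relation.** -/
theorem soloInformed_of_sub_of_posShearSheet_mem (ρ : IntegralRep (n + 1)) (S : Set (Fin n → ℝ))
    (h g : (Fin n → ℝ) → ℝ) (hS : IsSemialgebraic ℚ S) (hSo : IsOpen S)
    (hh : IsSemialgebraicFunOn ℚ S h) (hg : IsSemialgebraicFunOn ℚ S g)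
    (hhs : ContDiffOn ℝ ∞ h S) (hgs : ContDiffOn ℝ ∞ g S)
    (hdom : ρ.domain = KZlog.band S (fun _ => 0) (fun _ => 1))
    (hint : ∀ z ∈ ρ.domain, ρ.integrand z = g (Fin.init z)) (hpos : ∀ x ∈ S, 0 < g x) :
    of ρ - of (soloInformedPosShearSheet ρ S h g hS hSo hh hg hhs hgs hdom hint hpos) ∈
      soloInformedEquidimRelations :=
  soloInformed_of_sub_of_posSheet_mem ρ _ _ _ _ _ _ _

/-- **Negative shear sheet** of a slab piece (`g < 0` on `S`). -/
def soloInformedNegShearSheet (ρ : IntegralRep (n + 1)) (S : Set (Fin n → ℝ))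
    (h g : (Fin n → ℝ) → ℝ) (hS : IsSemialgebraic ℚ S) (hSo : IsOpen S)
    (hh : IsSemialgebraicFunOn ℚ S h) (hg : IsSemialgebraicFunOn ℚ S g)
    (hhs : ContDiffOn ℝ ∞ h S) (hgs : ContDiffOn ℝ ∞ g S)
    (hdom : ρ.domain = KZlog.band S (fun _ => 0) (fun _ => 1))
    (hint : ∀ z ∈ ρ.domain, ρ.integrand z = g (Fin.init z)) (hneg : ∀ x ∈ S, g x < 0) :
    IntegralRep (n + 1) :=
  soloInformedNegSheet ρ (soloInformedShear h g) (fun z => fderiv ℝ (soloInformedShear h g) z)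
    (soloInformed_slab_hF hS hh hg hdom) (soloInformed_slab_hd hSo hhs hgs hdom)
    (soloInformed_slab_hconv hdom) (soloInformed_slab_hjac hSo hhs hgs hdom hint)
    (fun z hz => by rw [hint z hz]; exact hneg _ (soloInformed_init_mem_of_slab hdom hz))

/-- The negative shear sheet has domain `Ψ_G '' ρ.domain`. -/
@[simp] theorem soloInformed_negShearSheet_domain (ρ : IntegralRep (n + 1)) (S : Set (Fin n → ℝ))
    (h g : (Fin n → ℝ) → ℝ) (hS : IsSemialgebraic ℚ S) (hSo : IsOpen S)
    (hh : IsSemialgebraicFunOn ℚ S h) (hg : IsSemialgebraicFunOn ℚ S g)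
    (hhs : ContDiffOn ℝ ∞ h S) (hgs : ContDiffOn ℝ ∞ g S)
    (hdom : ρ.domain = KZlog.band S (fun _ => 0) (fun _ => 1))
    (hint : ∀ z ∈ ρ.domain, ρ.integrand z = g (Fin.init z)) (hneg : ∀ x ∈ S, g x < 0) :
    (soloInformedNegShearSheet ρ S h g hS hSo hh hg hhs hgs hdom hint hneg).domain =
      soloInformedLastSubst (soloInformedShear h g) '' ρ.domain :=
  rfl

/-- The negative shear sheet has integrand `1`. -/
@[simp] theorem soloInformed_negShearSheet_integrand (ρ : IntegralRep (n + 1))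
    (S : Set (Fin n → ℝ)) (h g : (Fin n → ℝ) → ℝ) (hS : IsSemialgebraic ℚ S) (hSo : IsOpen S)
    (hh : IsSemialgebraicFunOn ℚ S h) (hg : IsSemialgebraicFunOn ℚ S g)
    (hhs : ContDiffOn ℝ ∞ h S) (hgs : ContDiffOn ℝ ∞ g S)
    (hdom : ρ.domain = KZlog.band S (fun _ => 0) (fun _ => 1))
    (hint : ∀ z ∈ ρ.domain, ρ.integrand z = g (Fin.init z)) (hneg : ∀ x ∈ S, g x < 0) :
    (soloInformedNegShearSheet ρ S h g hS hSo hh hg hhs hgs hdom hint hneg).integrand =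
      fun _ => 1 :=
  rfl

/-- **The slab piece plus its negative shear sheet is a relation.** -/
theorem soloInformed_of_add_of_negShearSheet_mem (ρ : IntegralRep (n + 1)) (S : Set (Fin n → ℝ))
    (h g : (Fin n → ℝ) → ℝ) (hS : IsSemialgebraic ℚ S) (hSo : IsOpen S)
    (hh : IsSemialgebraicFunOn ℚ S h) (hg : IsSemialgebraicFunOn ℚ S g)
    (hhs : ContDiffOn ℝ ∞ h S) (hgs : ContDiffOn ℝ ∞ g S)
    (hdom : ρ.domain = KZlog.band S (fun _ => 0) (fun _ => 1))
    (hint : ∀ z ∈ ρ.domain, ρ.integrand z = g (Fin.init z)) (hneg : ∀ x ∈ S, g x < 0) :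
    of ρ + of (soloInformedNegShearSheet ρ S h g hS hSo hh hg hhs hgs hdom hint hneg) ∈
      soloInformedEquidimRelations :=
  soloInformed_of_add_of_negSheet_mem ρ _ _ _ _ _ _ _

/-! ### Fibres of the sheared slab and the signed multiplicity -/

/-- **Fibres of the sheared slab**: `w ∈ Ψ_G '' (S × [0,1])` iff `init w ∈ S` and
`w last = h x + t·g x` for some `t ∈ [0,1]` (`x = init w`). -/
theorem soloInformed_mem_image_shear_iff
    (hdom : ρ.domain = KZlog.band S (fun _ => 0) (fun _ => 1)) {w : Fin (n + 1) → ℝ} :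
    w ∈ soloInformedLastSubst (soloInformedShear h g) '' ρ.domain ↔
      Fin.init w ∈ S ∧ ∃ t ∈ Icc (0 : ℝ) 1,
        w (Fin.last n) = h (Fin.init w) + t * g (Fin.init w) := by
  rw [soloInformed_mem_image_lastSubst_iff]
  constructor
  · rintro ⟨t, ht, hwt⟩
    rw [soloInformed_mem_fibre, hdom, KZlog.snoc_mem_band] at ht
    have hwt' : soloInformedShear h g (Fin.snoc (Fin.init w) t) = w (Fin.last n) := hwt
    exact ⟨ht.1, t, ht.2, by rw [← hwt', soloInformed_shear_snoc]⟩
  · rintro ⟨hx, t, ht, hwt⟩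
    refine ⟨t, ?_, ?_⟩
    · rw [soloInformed_mem_fibre, hdom, KZlog.snoc_mem_band]
      exact ⟨hx, ht⟩
    · show soloInformedShear h g (Fin.snoc (Fin.init w) t) = w (Fin.last n)
      rw [soloInformed_shear_snoc, hwt]

/-- The affine image of `[0,1]`, increasing case. -/
theorem soloInformed_exists_Icc_affine_iff_of_pos {u v y : ℝ} (hv : 0 < v) :
    (∃ t ∈ Icc (0 : ℝ) 1, y = u + t * v) ↔ u ≤ y ∧ y ≤ u + v := by
  constructor
  · rintro ⟨t, ⟨h0, h1⟩, rfl⟩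
    constructor <;> nlinarith
  · rintro ⟨h1, h2⟩
    have hv' : v ≠ 0 := hv.ne'
    refine ⟨(y - u) / v, ⟨div_nonneg (by linarith) hv.le, (div_le_one hv).2 (by linarith)⟩, ?_⟩
    field_simp
    ring

/-- The affine image of `[0,1]`, decreasing case. -/
theorem soloInformed_exists_Icc_affine_iff_of_neg {u v y : ℝ} (hv : v < 0) :
    (∃ t ∈ Icc (0 : ℝ) 1, y = u + t * v) ↔ u + v ≤ y ∧ y ≤ u := by
  constructor
  · rintro ⟨t, ⟨h0, h1⟩, rfl⟩
    constructor <;> nlinarith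
  · rintro ⟨h1, h2⟩
    have hv' : v ≠ 0 := hv.ne
    refine ⟨(y - u) / v, ⟨div_nonneg_of_nonpos (by linarith) hv.le,
      (div_le_one_of_neg hv).2 (by linarith)⟩, ?_⟩
    field_simp
    ring

open Classical in
/-- **Signed multiplicity of a sheared slab.**  Off the graphs of `h` and `h + g`, the signed
indicator of the sheared slab over a base point `x ∈ S` with `sign (g x) = ε` is the signed
interval indicator `sInd (h x) (h x + g x)`. -/
theorem soloInformed_sign_mul_indicator_image_shear
    (hdom : ρ.domain = KZlog.band S (fun _ => 0) (fun _ => 1)) {w : Fin (n + 1) → ℝ}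
    (hx : Fin.init w ∈ S) {ε : ℤ}
    (hε : (ε = 1 ∧ 0 < g (Fin.init w)) ∨ (ε = -1 ∧ g (Fin.init w) < 0))
    (hy₁ : w (Fin.last n) ≠ h (Fin.init w))
    (hy₂ : w (Fin.last n) ≠ h (Fin.init w) + g (Fin.init w)) :
    ε * (if w ∈ soloInformedLastSubst (soloInformedShear h g) '' ρ.domain then 1 else 0) =
      soloInformedSInd (h (Fin.init w)) (h (Fin.init w) + g (Fin.init w)) (w (Fin.last n)) := by
  rw [soloInformed_mem_image_shear_iff hdom, soloInformed_sInd_eq_ite hy₁ hy₂]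
  rcases hε with ⟨rfl, hpos⟩ | ⟨rfl, hneg⟩
  · rw [soloInformed_exists_Icc_affine_iff_of_pos hpos]
    have hno : ¬ (h (Fin.init w) + g (Fin.init w) < w (Fin.last n) ∧
        w (Fin.last n) < h (Fin.init w)) := fun hc => by linarith [hc.1, hc.2]
    rw [if_neg hno, sub_zero, one_mul]
    by_cases hin : h (Fin.init w) < w (Fin.last n) ∧
        w (Fin.last n) < h (Fin.init w) + g (Fin.init w)
    · rw [if_pos hin, if_pos ⟨hx, hin.1.le, hin.2.le⟩]
    · rw [if_neg hin, if_neg]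
      rintro ⟨-, h1, h2⟩
      exact hin ⟨lt_of_le_of_ne h1 (Ne.symm hy₁), lt_of_le_of_ne h2 hy₂⟩
  · rw [soloInformed_exists_Icc_affine_iff_of_neg hneg]
    have hno : ¬ (h (Fin.init w) < w (Fin.last n) ∧
        w (Fin.last n) < h (Fin.init w) + g (Fin.init w)) := fun hc => by linarith [hc.1, hc.2]
    rw [if_neg hno, zero_sub, neg_one_mul, neg_inj]
    by_cases hin : h (Fin.init w) + g (Fin.init w) < w (Fin.last n) ∧
        w (Fin.last n) < h (Fin.init w)
    · rw [if_pos hin, if_pos ⟨hx, hin.1.le, hin.2.le⟩]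
    · rw [if_neg hin, if_neg]
      rintro ⟨-, h1, h2⟩
      exact hin ⟨lt_of_le_of_ne h1 (Ne.symm hy₂), lt_of_le_of_ne h2 hy₁⟩

open Classical in
/-- Off the base cell the sheared slab has empty fibres. -/
theorem soloInformed_indicator_image_shear_of_not_mem
    (hdom : ρ.domain = KZlog.band S (fun _ => 0) (fun _ => 1)) {w : Fin (n + 1) → ℝ}
    (hx : Fin.init w ∉ S) :
    (if w ∈ soloInformedLastSubst (soloInformedShear h g) '' ρ.domain then (1 : ℤ) else 0) = 0 :=
  if_neg (soloInformed_not_mem_image_lastSubst (fun _ hz => soloInformed_init_mem_of_slab hdom hz) hx)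

end Slab

end Summit.KontsevichZagierPeriods.KontsevichZagierPeriods.Theorems
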